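import Mathlib.Analysis.SpecialFunctions.Pow.Real
import Literature.Computability.Complexity.SwitchingLemma
import Literature.Computability.Complexity.CircuitRestriction
import Literature.Computability.Complexity.CircuitLowerBounds
import HarnessLib

/-!
# Håstad's theorem: parity needs exponential size in constant depth (proof of `hastad_parity`, pnp.S21)

This file DISCHARGES (D-0014) the named fact `Literature.Computability.Complexity.hastad_parity`
of `CircuitLowerBounds.lean` (Håstad, STOC 1986, Thm. 1; Jukna 2012, Thm. 12.3):

* `hastad_parity_holds : hastad_parity` — for every depth `k ≥ 2` there are `c > 0` (we take
  `c = 1/262`) and `N` (we take `N = 786^{k-1}`) such that for all `n ≥ N` every circuit over the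
  unbounded fan-in basis `acBasis = {¬} ∪ {∧ₘ, ∨ₘ | m}` of `acDepth ≤ k` (negations free)
  computing `PARITYₙ` has at least `2 ^ (c · n^{1/(k-1)})` gates.

Everything here is proved; the combinatorial heart — the switching lemma — is the Razborov–Beame
encoding already proved in `SwitchingLemma.lean` (`badCode_injOn`, there packaged with the
`R_p`-weights as Håstad's multi-switching lemma); we only re-count it.

## Proof architecture (Håstad 1986, proof of Thm. 1, in the decision-tree form of Beame's primer)

* **Fixed number of free variables** (`PAssign.rext`, `switching_rext`). For a partial assignment
  `τ` with `v` free variables, `τ.rext ℓ` is the set of its extensions leaving exactly `ℓ`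
  variables free; `|τ.rext ℓ| = C(v, ℓ) · K` (`PAssign.card_rext`). For a DNF `F` of width `≤ t`
  (repetition-free terms) the extensions `ρ ∈ τ.rext ℓ` whose canonical decision tree `cdt F ρ`
  is deeper than `s` are mapped injectively by the Razborov–Beame code (`badCode`, with `m = 1`
  formula, `D = s + 1`) into `codes × τ.rext (ℓ - s - 1)`, the third component `ρ*` fixing the
  `s + 1` queried variables (`badStar_mem_rext`); hence (`card_bad_rext_le`, `switching_rext`)
  `#bad · (v - ℓ + 1)^{s+1} ≤ |τ.rext ℓ| · 2 (32(t+1)+1)^{s+1} ℓ^{s+1}`, i.e. the classical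
  `Pr[depth > s] ≤ (C t ℓ/(v-ℓ))^{s+1}` with `C = 66`, no probability needed.
* **Decision-tree glue** (`DecisionTree.restrict`, `.negate`, `.pathDNF`): restricting and negating
  trees, and the DNF of accepting paths (width `≤` depth, repetition-free terms,
  `DecisionTree.evalDNF_pathDNF`).
* **Wire functions and heights** of straight-line programs (`GateList.wireFn`, `GateList.wireHt`,
  the gate equations `wireFn_gate`/`wireHt_gate`, and the shape of `acBasis` gates): the model of
  `Circuit.lean` is not layered and negations may occur anywhere (weight `0` in `acDepth`), which
  the decision-tree form of the argument handles uniformly.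
* **The invariant** (`HastadParity.Inv gs τ h d`): after `h` rounds every gate of
  `acWeight`-height `≤ h` computes, under the current restriction `τ`, a function with a decision
  tree of depth `≤ d` (`d = 1` for `h = 0`: chains of negations over an input, `inv_zero`; `d = s`
  afterwards). **Step** (`inv_step`): an `∨` (resp. `∧`) gate of height `h + 1` is, under `τ`, the
  `d`-DNF `gateDNF` made of the path DNFs of its children's trees (resp. of the negated trees, a
  DNF for the negated gate); if the canonical decision tree of `gateDNF|ρ` has depth `≤ s` for a
  refinement `ρ` of `τ` then the gate has a tree of depth `≤ s` under `ρ`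
  (`exists_decisionTree_of_cdt_le` of `SwitchingLemma.lean`). **Round** (`round_exists`): by the
  counting switching lemma and a union bound over the `< 2^s` gates, a good `ρ ∈ τ.rext ℓ` exists
  as soon as `(2(32(d+1)+1)+1) ℓ ≤ v + 1`. **Schedule** (`sched`): `n`, `n/131` (first round,
  `d = 1`), then division by `64 s + 67` (`d = s`) at each of the remaining `k - 2` rounds
  (`rounds`); `(131(s+1))^{k-1} ≤ n` keeps `s + 1` variables to the end (`le_sched`).
* **The end** (`hasSmallDNF_or`, `not_hasSmallDNF_of_sensitive`, `two_pow_le_size`): after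
  `k - 1` rounds the output (height `≤ k`) is an `s`-DNF or an `s`-CNF of the parity of the
  `≥ s + 1` surviving variables (up to the fixed ones), impossible since a satisfied term of
  width `≤ s` misses a free variable whose flip changes the parity. Hence `size ≥ 2^s`, and with
  `s = ⌊n^{1/(k-1)}⌋/131 - 1 ≥ n^{1/(k-1)}/262` for `n ≥ 786^{k-1}` the real-exponent form follows
  (`hastad_parity_holds`).

The constants (`c = 1/262`; Håstad's are `c_k → 1/10`-ish) are not optimised.

## References

* J. Håstad, *Almost optimal lower bounds for small depth circuits*, Proc. 18th STOC (1986),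
  6–20, Thm. 1; *Computational limitations of small-depth circuits*, PhD thesis, MIT Press (1987)
  [Hastad1986].
* P. Beame, *A switching lemma primer*, Tech. Report UW-CSE-95-07-01, Univ. of Washington (1994),
  §3 (Razborov's proof; decision-tree version) [Beame1994].
* S. Jukna, *Boolean Function Complexity: Advances and Frontiers*, Springer (2012), §12.1–12.3,
  Lemma 12.1 (Razborov 1995), Thm. 12.2, Thm. 12.3 (p. 339: "any depth-(d+1) alternating circuit
  computing the parity of n variables requires 2^{Ω(n^{1/d})} gates") [Jukna2012].
* J. Håstad, *On the correlation of parity and small-depth circuits*, SIAM J. Comput. 43 (2014),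
  §3 (the multi-switching lemma proved in `SwitchingLemma.lean`) [Hastad2014].
-/

noncomputable section

namespace Literature.Computability.Complexity

open Finset

variable {n : ℕ}

/-! ### Decision trees: restriction, negation, the DNF of the accepting paths -/

namespace DecisionTree

/-- The restriction `T|σ` of a decision tree by a partial assignment: queries of fixed variables
are resolved by their fixed value. [folklore] -/
def restrict (σ : PAssign n) : DecisionTree n → DecisionTree n
  | leaf b => leaf b
  | query i t₀ t₁ =>
    if i ∈ σ.dom then (if σ.val i then t₁.restrict σ else t₀.restrict σ)
    else query i (t₀.restrict σ) (t₁.restrict σ)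

/-- `T|σ` computes `x ↦ T (σ.apply x)`. [folklore] -/
theorem eval_restrict (σ : PAssign n) (x : Fin n → Bool) :
    ∀ T : DecisionTree n, (T.restrict σ).eval x = T.eval (σ.apply x)
  | leaf b => rfl
  | query i t₀ t₁ => by
    unfold restrict
    by_cases hi : i ∈ σ.dom
    · rw [if_pos hi, eval_query, PAssign.apply_apply, if_pos hi]
      cases σ.val i
      · simpa using eval_restrict σ x t₀
      · simpa using eval_restrict σ x t₁
    · rw [if_neg hi, eval_query, eval_query, PAssign.apply_apply, if_neg hi, eval_restrict σ x t₀,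
        eval_restrict σ x t₁]

/-- Restriction does not increase the depth. [folklore] -/
theorem depth_restrict_le (σ : PAssign n) : ∀ T : DecisionTree n, (T.restrict σ).depth ≤ T.depth
  | leaf b => le_rfl
  | query i t₀ t₁ => by
    unfold restrict
    have h₀ := depth_restrict_le σ t₀
    have h₁ := depth_restrict_le σ t₁
    split_ifs <;> simp only [depth_query] <;> omega

/-- The negated tree (leaf labels flipped). [folklore] -/
def negate : DecisionTree n → DecisionTree n
  | leaf b => leaf (!b)
  | query i t₀ t₁ => query i t₀.negate t₁.negate

/-- The negated tree computes the negation. [folklore] -/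
theorem eval_negate (x : Fin n → Bool) : ∀ T : DecisionTree n, T.negate.eval x = !T.eval x
  | leaf b => rfl
  | query i t₀ t₁ => by
    simp only [negate, eval_query, eval_negate x t₀, eval_negate x t₁]
    split <;> rfl

/-- Negation keeps the depth. [folklore] -/
@[simp] theorem depth_negate : ∀ T : DecisionTree n, T.negate.depth = T.depth
  | leaf b => rfl
  | query i t₀ t₁ => by simp only [negate, depth_query, depth_negate t₀, depth_negate t₁]

/-- The tree reading one variable. [folklore] -/
def var (i : Fin n) : DecisionTree n := query i (leaf false) (leaf true)

/-- `var i` computes `x ↦ x i`. [folklore] -/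
@[simp] theorem eval_var (i : Fin n) (x : Fin n → Bool) : (var i).eval x = x i := by
  unfold var; rw [eval_query]; cases x i <;> rfl

/-- `var i` has depth `1`. [folklore] -/
@[simp] theorem depth_var (i : Fin n) : (var i : DecisionTree n).depth = 1 := rfl

/-- The accepting paths of a decision tree as the terms of a DNF (`CNF (Fin n)` read
disjunctively): `acc` is the list of literals already fixed on the current path (a repeated query
follows the branch consistent with it). [folklore] -/
def pathDNF : DecisionTree n → Clause (Fin n) → CNF (Fin n)
  | leaf b, acc => if b then [acc] else []
  | query i t₀ t₁, acc =>
    match acc.find? (fun l => l.1 = i) with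
    | some l => if l.2 then t₁.pathDNF acc else t₀.pathDNF acc
    | none => t₀.pathDNF ((i, false) :: acc) ++ t₁.pathDNF ((i, true) :: acc)

/-- Terms of the path DNF have length at most the depth plus the length of the prefix. [folklore] -/
theorem length_le_of_mem_pathDNF : ∀ (T : DecisionTree n) (acc : Clause (Fin n)),
    ∀ C ∈ T.pathDNF acc, C.length ≤ T.depth + acc.length
  | leaf b, acc, C, hC => by
    unfold pathDNF at hC
    split_ifs at hC
    · simp only [List.mem_singleton] at hC; subst hC; simp
    · simp at hC
  | query i t₀ t₁, acc, C, hC => by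
    unfold pathDNF at hC
    simp only [depth_query]
    split at hC
    · split_ifs at hC
      · have := length_le_of_mem_pathDNF t₁ acc C hC; omega
      · have := length_le_of_mem_pathDNF t₀ acc C hC; omega
    · rcases List.mem_append.1 hC with h | h
      · have := length_le_of_mem_pathDNF t₀ _ C h
        simp only [List.length_cons] at this; omega
      · have := length_le_of_mem_pathDNF t₁ _ C h
        simp only [List.length_cons] at this; omega

/-- Terms of the path DNF have pairwise distinct variables (if the prefix has). [folklore] -/
theorem varNodup_of_mem_pathDNF : ∀ (T : DecisionTree n) (acc : Clause (Fin n)), VarNodup acc →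
    ∀ C ∈ T.pathDNF acc, VarNodup C
  | leaf b, acc, hacc, C, hC => by
    unfold pathDNF at hC
    split_ifs at hC
    · simp only [List.mem_singleton] at hC; subst hC; exact hacc
    · simp at hC
  | query i t₀ t₁, acc, hacc, C, hC => by
    unfold pathDNF at hC
    split at hC
    · split_ifs at hC
      · exact varNodup_of_mem_pathDNF t₁ acc hacc C hC
      · exact varNodup_of_mem_pathDNF t₀ acc hacc C hC
    · rename_i hnone
      have hi : i ∉ acc.map Prod.fst := by
        intro hi
        obtain ⟨l, hl, rfl⟩ := List.mem_map.1 hi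
        have := List.find?_eq_none.1 hnone l hl
        simp at this
      have hcons : ∀ b : Bool, VarNodup ((i, b) :: acc) := fun b => by
        unfold VarNodup at hacc ⊢
        rw [List.map_cons]
        exact List.nodup_cons.2 ⟨hi, hacc⟩
      rcases List.mem_append.1 hC with h | h
      · exact varNodup_of_mem_pathDNF t₀ _ (hcons false) C h
      · exact varNodup_of_mem_pathDNF t₁ _ (hcons true) C h

/-- Semantics of the path DNF: an input satisfies some term iff it agrees with the prefix and is
accepted by the tree. [folklore] -/
theorem any_pathDNF (x : Fin n → Bool) : ∀ (T : DecisionTree n) (acc : Clause (Fin n)),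
    ((T.pathDNF acc).any fun C => C.all (Literal.eval x)) = (acc.all (Literal.eval x) && T.eval x)
  | leaf b, acc => by
    unfold pathDNF
    cases b <;> simp
  | query i t₀ t₁, acc => by
    unfold pathDNF
    split
    · rename_i l hl
      have hlacc : l ∈ acc := List.mem_of_find?_eq_some hl
      have hli : l.1 = i := by simpa using List.find?_some hl
      by_cases hall : acc.all (Literal.eval x) = true
      · have hx : x i = l.2 := by
          have := List.all_eq_true.1 hall l hlacc
          simpa [Literal.eval, hli] using this
        split_ifs with hb
        · rw [any_pathDNF x t₁ acc, eval_query, hx, hb]; rfl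
        · rw [any_pathDNF x t₀ acc, eval_query, hx]
          simp [hb]
      · have hall' : acc.all (Literal.eval x) = false := eq_false_of_ne_true hall
        split_ifs
        · rw [any_pathDNF x t₁ acc, hall']; rfl
        · rw [any_pathDNF x t₀ acc, hall']; rfl
    · rw [List.any_append, any_pathDNF x t₀, any_pathDNF x t₁, eval_query]
      simp only [List.all_cons, Literal.eval]
      cases x i <;> cases acc.all (Literal.eval x) <;> simp

/-- The path DNF of `T` (empty prefix) is a DNF for the function computed by `T`. [folklore] -/
theorem evalDNF_pathDNF (T : DecisionTree n) (x : Fin n → Bool) :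
    (T.pathDNF []).evalDNF x = T.eval x := by
  have := any_pathDNF x T []
  simpa [CNF.evalDNF] using this

/-- Terms of `T.pathDNF []` have width at most the depth of `T`. [folklore] -/
theorem length_le_depth_of_mem_pathDNF (T : DecisionTree n) {C : Clause (Fin n)}
    (hC : C ∈ T.pathDNF []) : C.length ≤ T.depth := by
  simpa using length_le_of_mem_pathDNF T [] C hC

/-- Terms of `T.pathDNF []` have pairwise distinct variables. [folklore] -/
theorem varNodup_of_mem_pathDNF_nil (T : DecisionTree n) {C : Clause (Fin n)}
    (hC : C ∈ T.pathDNF []) : VarNodup C :=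
  varNodup_of_mem_pathDNF T [] (by simp [VarNodup]) C hC

end DecisionTree

/-! ### Extensions leaving a fixed number of variables free -/

namespace PAssign

/-- The extensions of `τ` leaving exactly `ℓ` variables free (values on `dom τ` unchanged; the
junk values off the domain are arbitrary). [cite: Beame1994, §3] -/
def rext (τ : PAssign n) (ℓ : ℕ) : Finset (PAssign n) :=
  univ.filter fun ρ => τ.dom ⊆ ρ.dom ∧ ρ.free.card = ℓ ∧ ∀ i ∈ τ.dom, ρ.val i = τ.val i

/-- Membership in `τ.rext ℓ`. [folklore] -/
theorem mem_rext {τ ρ : PAssign n} {ℓ : ℕ} :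
    ρ ∈ τ.rext ℓ ↔ τ.dom ⊆ ρ.dom ∧ ρ.free.card = ℓ ∧ ∀ i ∈ τ.dom, ρ.val i = τ.val i := by
  simp [rext]

/-- An extension refines: restricting by `τ` and then by `ρ ∈ τ.rext ℓ` is restricting by `ρ`. [folklore] -/
theorem apply_apply_of_mem_rext {τ ρ : PAssign n} {ℓ : ℕ} (h : ρ ∈ τ.rext ℓ) (x : Fin n → Bool) :
    τ.apply (ρ.apply x) = ρ.apply x := by
  obtain ⟨hdom, -, hval⟩ := mem_rext.1 h
  funext i
  simp only [apply_apply]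
  by_cases hi : i ∈ τ.dom
  · rw [if_pos hi, if_pos (hdom hi), hval i hi]
  · rw [if_neg hi]

/-- `τ` itself, seen with `ℓ = |free τ|`. [folklore] -/
theorem self_mem_rext (τ : PAssign n) : τ ∈ τ.rext τ.free.card :=
  mem_rext.2 ⟨Subset.rfl, rfl, fun _ _ => rfl⟩

/-- The domains of the members of `τ.rext ℓ`. [folklore] -/
def domPart (τ : PAssign n) (ℓ : ℕ) : Finset (Finset (Fin n)) :=
  univ.filter fun A => τ.dom ⊆ A ∧ (univ \ A).card = ℓ

/-- The value functions of the members of `τ.rext ℓ`. [folklore] -/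
def valPart (τ : PAssign n) : Finset (Fin n → Bool) :=
  univ.filter fun v => ∀ i ∈ τ.dom, v i = τ.val i

/-- `valPart` is nonempty (it contains `τ.val`). [folklore] -/
theorem card_valPart_pos (τ : PAssign n) : 0 < τ.valPart.card :=
  Finset.card_pos.2 ⟨τ.val, by simp [valPart]⟩

/-- `|domPart τ ℓ| = C(|free τ|, ℓ)` (choose the free variables that stay free). [folklore] -/
theorem card_domPart (τ : PAssign n) (ℓ : ℕ) : (τ.domPart ℓ).card = τ.free.card.choose ℓ := by
  classical
  have h : τ.domPart ℓ = (powersetCard ℓ τ.free).map ⟨compl, compl_injective⟩ := by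
    ext A
    simp only [domPart, mem_filter, mem_univ, true_and, mem_map, mem_powersetCard,
      Function.Embedding.coeFn_mk, free]
    constructor
    · rintro ⟨hsub, hcard⟩
      refine ⟨Aᶜ, ⟨?_, ?_⟩, compl_compl A⟩
      · intro i hi
        rw [mem_compl] at hi
        exact mem_sdiff.2 ⟨mem_univ _, fun h => hi (hsub h)⟩
      · rw [compl_eq_univ_sdiff]; exact hcard
    · rintro ⟨B, ⟨hB, hcard⟩, rfl⟩
      refine ⟨fun i hi => ?_, ?_⟩
      · rw [mem_compl]
        intro hiB
        exact (mem_sdiff.1 (hB hiB)).2 hi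
      · rw [← compl_eq_univ_sdiff, compl_compl]; exact hcard
  rw [h, card_map, card_powersetCard]

/-- `|τ.rext ℓ| = C(|free τ|, ℓ) · |valPart τ|`. [folklore] -/
theorem card_rext (τ : PAssign n) (ℓ : ℕ) : (τ.rext ℓ).card = τ.free.card.choose ℓ * τ.valPart.card := by
  classical
  have h : τ.rext ℓ = ((τ.domPart ℓ) ×ˢ τ.valPart).map PAssign.equivProd.symm.toEmbedding := by
    ext ρ
    rw [mem_map_equiv, Equiv.symm_symm, mem_product]
    simp only [mem_rext, domPart, valPart, mem_filter, mem_univ, true_and, PAssign.equivProd,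
      Equiv.coe_fn_mk, free]
    tauto
  rw [h, card_map, card_product, card_domPart]

end PAssign

open PAssign

/-! ### Binomial comparison -/

/-- `C(v, j) (v-j-D+1)^D ≤ C(v, j+D) (j+D)^D` for `j + D ≤ v`. [folklore] -/
theorem choose_mul_pow_le_choose_add (v j : ℕ) : ∀ D : ℕ, j + D ≤ v →
    v.choose j * (v - j - D + 1) ^ D ≤ v.choose (j + D) * (j + D) ^ D
  | 0, _ => by simp
  | D + 1, h => by
    have ih := choose_mul_pow_le_choose_add v j D (by omega)
    have e1 : v - j - (D + 1) + 1 = v - j - D := by omega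
    have hstep : v.choose (j + D + 1) * (j + D + 1) = v.choose (j + D) * (v - (j + D)) :=
      Nat.choose_succ_right_eq v (j + D)
    have e2 : v - (j + D) = v - j - D := by omega
    calc v.choose j * (v - j - (D + 1) + 1) ^ (D + 1)
        = v.choose j * (v - j - D) ^ D * (v - j - D) := by rw [e1, pow_succ, mul_assoc]
      _ ≤ v.choose j * (v - j - D + 1) ^ D * (v - j - D) :=
          Nat.mul_le_mul_right _ (Nat.mul_le_mul_left _ (Nat.pow_le_pow_left (Nat.le_succ _) D))
      _ ≤ v.choose (j + D) * (j + D) ^ D * (v - j - D) := Nat.mul_le_mul_right _ ih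
      _ = v.choose (j + D + 1) * (j + D + 1) * (j + D) ^ D := by
          rw [hstep, e2, Nat.mul_right_comm]
      _ ≤ v.choose (j + D + 1) * (j + D + 1) * (j + D + 1) ^ D :=
          Nat.mul_le_mul_left _ (Nat.pow_le_pow_left (Nat.le_succ _) D)
      _ = v.choose (j + (D + 1)) * (j + (D + 1)) ^ (D + 1) := by
          rw [← add_assoc]; ring

/-! ### The switching lemma for restrictions leaving exactly `ℓ` variables free -/

section Fixed

variable (F : CNF (Fin n)) (t s : ℕ)

/-- A single DNF as a family of one. [folklore] -/
def singleDNF : Fin 1 → CNF (Fin n) := fun _ => F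

/-- If the canonical decision tree of `F|ρ` is deeper than `s`, the canonical common `s`-partial
tree of the one-member family `{F}` queries at least `s + 1` variables. [cite: Hastad2014, §3] -/
theorem succ_le_ccDepth_of_lt_cdt (hF : ∀ C ∈ F, VarNodup C) {ρ : PAssign n} (h : s < cdt F ρ) :
    s + 1 ≤ ccDepth s (singleDNF F) n ρ := by
  have hF' : ∀ i, ∀ C ∈ singleDNF F i, VarNodup C := fun _ => hF
  cases n with
  | zero => simp [cdt, cdtF] at h
  | succ n' =>
    have hex : ∃ i : Fin 1, s < cdt (singleDNF F i) ρ := ⟨0, h⟩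
    have hQ : swQuery s (singleDNF F) ρ = pathVarSet (longPath s F ρ) := by
      unfold swQuery; rw [dif_pos hex]; rfl
    have hP := longPath_spec s (Fi := F) h
    have hnd := PathValid.nodup_free hF hP.1
    have hcard : (pathVarSet (longPath s F ρ)).card = pathLen (longPath s F ρ) := by
      rw [pathVarSet, List.toFinset_card_of_nodup hnd.1, length_pathVars]
    have hne : swQuery s (singleDNF F) ρ ≠ ∅ := by
      intro he
      rw [hQ] at he
      rw [he, card_empty] at hcard
      omega
    show s + 1 ≤ procDepth (swQuery s (singleDNF F)) (n' + 1) ρ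
    unfold procDepth
    rw [if_neg hne, hQ, hcard]
    omega

/-- The encoding restriction `ρ*` of a bad `ρ ∈ τ.rext ℓ` lies in `τ.rext (ℓ - (s+1))`. [cite: Beame1994, §3] -/
theorem badStar_mem_rext (hF : ∀ C ∈ F, VarNodup C) {τ ρ : PAssign n} {ℓ : ℕ} (hρ : ρ ∈ τ.rext ℓ)
    (h : s + 1 ≤ ccDepth s (singleDNF F) n ρ) :
    badStar s (singleDNF F) (s + 1) ρ ∈ τ.rext (ℓ - (s + 1)) := by
  have hF' : ∀ i, ∀ C ∈ singleDNF F i, VarNodup C := fun _ => hF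
  obtain ⟨hv, hlen, -⟩ := badWit_spec s (singleDNF F) (s + 1) (by omega) h
  obtain ⟨hcard, hdisj⟩ := WitValid.card_witVars s (singleDNF F) hF' hv
  rw [hlen] at hcard
  set W := (witVars (badWit s (singleDNF F) (s + 1) ρ)).toFinset with hW
  obtain ⟨hdom, hfree, hval⟩ := mem_rext.1 hρ
  have hWfree : W ⊆ ρ.free := fun i hi => mem_free.2 (Finset.disjoint_left.1 hdisj hi)
  change ρ.fix W (starVal (badWit s (singleDNF F) (s + 1) ρ)) ∈ τ.rext (ℓ - (s + 1))
  refine mem_rext.2 ⟨fun i hi => ?_, ?_, fun i hi => ?_⟩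
  · rw [fix_dom]; exact mem_union_left _ (hdom hi)
  · have := card_free_fix hWfree (starVal (badWit s (singleDNF F) (s + 1) ρ))
    omega
  · rw [fix_val, if_neg (fun hiW => Finset.disjoint_left.1 hdisj hiW (hdom hi)), hval i hi]

/-- **Counting form of the switching lemma on `τ.rext ℓ`**: the bad extensions (canonical tree of
`F|ρ` deeper than `s`) inject, via the Razborov–Beame code, into codes × `τ.rext (ℓ - (s+1))`.
[cite: Beame1994, §3] -/
theorem card_bad_rext_le (hF : ∀ C ∈ F, VarNodup C) (ht : ∀ C ∈ F, C.length ≤ t)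
    (τ : PAssign n) (ℓ : ℕ) :
    ((τ.rext ℓ).filter fun ρ => s < cdt F ρ).card ≤
      2 * (32 * (t + 1) + 1) ^ (s + 1) * (τ.rext (ℓ - (s + 1))).card := by
  classical
  have hF' : ∀ i, ∀ C ∈ singleDNF F i, VarNodup C := fun _ => hF
  have ht' : ∀ i, ∀ C ∈ singleDNF F i, C.length ≤ t := fun _ => ht
  set Bad := (τ.rext ℓ).filter fun ρ => s < cdt F ρ with hBad
  let T : Finset ((Fin ((s + 1 - 1) / (s + 1) + 1) → Option (Fin 1)) ×
      (Fin (s + 1) → Option ((Entry t × Bool) × Bool)) × PAssign n) :=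
    univ ×ˢ (univ ×ˢ τ.rext (ℓ - (s + 1)))
  have hmaps : ∀ ρ ∈ Bad, badCode s (singleDNF F) t (s + 1) ρ ∈ T := by
    intro ρ hρ
    obtain ⟨hρe, hρb⟩ := mem_filter.1 hρ
    simp only [T, mem_product, mem_univ, true_and, badCode]
    exact badStar_mem_rext F s hF hρe (succ_le_ccDepth_of_lt_cdt F s hF hρb)
  have hinj : Set.InjOn (badCode s (singleDNF F) t (s + 1)) Bad := by
    refine (badCode_injOn s (singleDNF F) t (s + 1) hF' ht' (by omega)).mono fun ρ hρ => ?_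
    have hρ' := mem_filter.1 (Finset.mem_coe.1 hρ)
    simp only [coe_filter, mem_univ, true_and, Set.mem_setOf_eq]
    exact succ_le_ccDepth_of_lt_cdt F s hF hρ'.2
  have hle := Finset.card_le_card_of_injOn _ hmaps hinj
  have hT : T.card = 2 * (32 * (t + 1) + 1) ^ (s + 1) * (τ.rext (ℓ - (s + 1))).card := by
    have e0 : (s + 1 - 1) / (s + 1) = 0 := Nat.div_eq_of_lt (by omega)
    simp only [T, card_product, card_univ, Fintype.card_fun, Fintype.card_option, Fintype.card_fin,
      Fintype.card_prod, Fintype.card_bool, card_Entry, e0]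
    ring
  rw [hT] at hle
  exact hle

/-- **Switching lemma, fixed number of free variables** (Håstad 1986 / Beame 1994, §3, counting
form): among the extensions of `τ` leaving exactly `ℓ` of its `v` free variables free, those for
which the canonical decision tree of `F|ρ` (a DNF of width `≤ t` with repetition-free terms) is
deeper than `s` are at most a fraction `2 (32(t+1)+1)^{s+1} (ℓ / (v - ℓ + 1))^{s+1}`, written
multiplied out over `ℕ`. [cite: Beame1994, §3] -/
theorem switching_rext (hF : ∀ C ∈ F, VarNodup C) (ht : ∀ C ∈ F, C.length ≤ t) (τ : PAssign n)
    {ℓ : ℕ} (hsl : s + 1 ≤ ℓ) (hlv : ℓ ≤ τ.free.card) :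
    ((τ.rext ℓ).filter fun ρ => s < cdt F ρ).card * (τ.free.card - ℓ + 1) ^ (s + 1) ≤
      (τ.rext ℓ).card * (2 * (32 * (t + 1) + 1) ^ (s + 1) * ℓ ^ (s + 1)) := by
  have h1 := card_bad_rext_le F t s hF ht τ ℓ
  rw [card_rext]
  have hch := choose_mul_pow_le_choose_add τ.free.card (ℓ - (s + 1)) (s + 1) (by omega)
  have e1 : ℓ - (s + 1) + (s + 1) = ℓ := by omega
  have e2 : τ.free.card - (ℓ - (s + 1)) - (s + 1) + 1 = τ.free.card - ℓ + 1 := by omega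
  rw [e1, e2] at hch
  calc ((τ.rext ℓ).filter fun ρ => s < cdt F ρ).card * (τ.free.card - ℓ + 1) ^ (s + 1)
      ≤ 2 * (32 * (t + 1) + 1) ^ (s + 1) * (τ.free.card.choose (ℓ - (s + 1)) * τ.valPart.card) *
          (τ.free.card - ℓ + 1) ^ (s + 1) := by
        have := Nat.mul_le_mul_right ((τ.free.card - ℓ + 1) ^ (s + 1)) h1
        rwa [card_rext] at this
    _ = 2 * (32 * (t + 1) + 1) ^ (s + 1) * τ.valPart.card *
          (τ.free.card.choose (ℓ - (s + 1)) * (τ.free.card - ℓ + 1) ^ (s + 1)) := by ring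
    _ ≤ 2 * (32 * (t + 1) + 1) ^ (s + 1) * τ.valPart.card *
          (τ.free.card.choose ℓ * ℓ ^ (s + 1)) := Nat.mul_le_mul_left _ hch
    _ = τ.free.card.choose ℓ * τ.valPart.card * (2 * (32 * (t + 1) + 1) ^ (s + 1) * ℓ ^ (s + 1)) := by
          ring

end Fixed

/-! ### Wire functions and heights of straight-line programs over `acBasis` -/

namespace GateList

variable {ι : Type*}

/-- The Boolean function carried by the wire `w` of the program `gs`. [folklore] -/
def wireFn (gs : List (Gate ι)) (w : ι ⊕ ℕ) (x : ι → Bool) : Bool := wireOf x (vals gs x) w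

/-- The `acWeight`-height of the wire `w` of the program `gs` (negations free). [cite: Vollmer1999, §1.2] -/
def wireHt (gs : List (Gate ι)) (w : ι ⊕ ℕ) : ℕ := wireDepthOf (wdepths acWeight gs) w

/-- An input wire carries the input bit. [folklore] -/
@[simp] theorem wireFn_inl (gs : List (Gate ι)) (i : ι) (x : ι → Bool) : wireFn gs (.inl i) x = x i := rfl

/-- An input wire has height `0`. [folklore] -/
@[simp] theorem wireHt_inl (gs : List (Gate ι)) (i : ι) : wireHt gs (.inl i) = 0 := rfl

/-- The circuit computes the function of its output wire. [folklore] -/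
theorem circuit_eval_eq_wireFn (C : Circuit ι) (x : ι → Bool) : C.eval x = wireFn C.gates C.output x :=
  circuit_eval C x

/-- `acDepth` is the height of the output wire. [folklore] -/
theorem circuit_acDepth_eq_wireHt (C : Circuit ι) : C.acDepth = wireHt C.gates C.output :=
  circuit_depthWith C acWeight

/-- Splitting a list at a position. [folklore] -/
theorem take_append_getElem_cons_drop (gs : List (Gate ι)) {j : ℕ} (hj : j < gs.length) :
    gs.take j ++ gs[j] :: gs.drop (j + 1) = gs := by
  rw [List.getElem_cons_drop, List.take_append_drop]

/-- The depth of the gate at position `pre.length` of `pre ++ g :: post`. [folklore] -/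
theorem getD_wdepths_append_cons (w : GateFn → ℕ) (pre : List (Gate ι)) (g : Gate ι) (post : List (Gate ι)) :
    (wdepths w (pre ++ g :: post)).getD pre.length 0 =
      w g.fn + univ.sup fun a => wireDepthOf (wdepths w pre) (g.args a) := by
  have e : pre ++ g :: post = (pre ++ [g]) ++ post := by simp
  rw [e]
  obtain ⟨ws, hws⟩ := wdepths_append_take w (pre ++ [g]) post
  rw [hws, List.getD_eq_getElem?_getD, List.getElem?_append_left (by simp), ← List.getD_eq_getElem?_getD,
    getD_wdepths_append_singleton]

/-- **Gate equation** (values): in a well-formed program the gate at position `j` applies its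
truth table to the functions of its argument wires. [folklore] -/
theorem wireFn_gate {gs : List (Gate ι)} (hwf : WF gs) {j : ℕ} (hj : j < gs.length) (x : ι → Bool) :
    wireFn gs (.inr j) x = (gs[j]).op fun a : Fin (gs[j]).arity => wireFn gs ((gs[j]).args a) x := by
  have hsplit := take_append_getElem_cons_drop gs hj
  have hlen : (gs.take j).length = j := List.length_take_of_le hj.le
  have h1 := getD_vals_append_cons (gs.take j) gs[j] (gs.drop (j + 1)) x
  rw [hsplit, hlen] at h1
  unfold wireFn
  rw [wireOf_inr, h1]
  congr 1
  funext a
  have hw : ∀ m, (gs[j]).args a = .inr m → m < (gs.take j).length := by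
    rw [hlen]; exact fun m hm => hwf j gs[j] (List.getElem?_eq_getElem hj) a m hm
  have h2 := wireOf_vals_append (gs.take j) (gs[j] :: gs.drop (j + 1)) x ((gs[j]).args a) hw
  rw [hsplit] at h2
  exact h2.symm

/-- **Gate equation** (heights): the height of the gate at position `j` is its weight plus the
maximal height of its argument wires. [folklore] -/
theorem wireHt_gate {gs : List (Gate ι)} (hwf : WF gs) {j : ℕ} (hj : j < gs.length) :
    wireHt gs (.inr j) = acWeight (gs[j]).fn + univ.sup fun a : Fin (gs[j]).arity => wireHt gs ((gs[j]).args a) := by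
  have hsplit := take_append_getElem_cons_drop gs hj
  have hlen : (gs.take j).length = j := List.length_take_of_le hj.le
  have h1 := getD_wdepths_append_cons acWeight (gs.take j) gs[j] (gs.drop (j + 1))
  rw [hsplit, hlen] at h1
  unfold wireHt
  rw [wireDepthOf_inr, h1]
  congr 1
  refine Finset.sup_congr rfl fun a _ => ?_
  have hw : OutOK (gs.take j).length ((gs[j]).args a) := by
    rw [hlen]; exact fun m hm => hwf j gs[j] (List.getElem?_eq_getElem hj) a m hm
  have h2 := wireDepthOf_wdepths_append acWeight (gs.take j) (gs[j] :: gs.drop (j + 1)) ((gs[j]).args a) hw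
  rw [hsplit] at h2
  exact h2.symm

/-- Arguments of the gate at position `j` refer to earlier gates. [folklore] -/
theorem args_lt {gs : List (Gate ι)} (hwf : WF gs) {j : ℕ} (hj : j < gs.length) (a : Fin (gs[j]).arity)
    {m : ℕ} (hm : (gs[j]).args a = .inr m) : m < j :=
  hwf j gs[j] (List.getElem?_eq_getElem hj) a m hm

/-- The truth table of a gate whose gate function is `∨ₖ`. [folklore] -/
theorem op_of_fn_eq_or {g : Gate ι} {k : ℕ} (h : g.fn = GateFn.or k) (v : Fin g.arity → Bool) :
    g.op v = decide (∃ a, v a = true) := by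
  obtain ⟨args, rfl⟩ := Gate.exists_eq_of_fn_eq h; rfl

/-- The truth table of a gate whose gate function is `∧ₖ`. [folklore] -/
theorem op_of_fn_eq_and {g : Gate ι} {k : ℕ} (h : g.fn = GateFn.and k) (v : Fin g.arity → Bool) :
    g.op v = decide (∀ a, v a = true) := by
  obtain ⟨args, rfl⟩ := Gate.exists_eq_of_fn_eq h; rfl

/-- A gate whose gate function is `¬` has one argument and negates it. [folklore] -/
theorem op_of_fn_eq_not {g : Gate ι} (h : g.fn = GateFn.not) :
    ∃ h1 : g.arity = 1, ∀ v : Fin g.arity → Bool, g.op v = !(v ⟨0, by omega⟩) := by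
  obtain ⟨args, rfl⟩ := Gate.exists_eq_of_fn_eq h
  exact ⟨rfl, fun v => rfl⟩

/-- **Negation gates**: the gate reads one wire `u` (an input or an earlier gate), negates it and
has the same height. [folklore] -/
theorem not_gate_spec {gs : List (Gate ι)} (hwf : WF gs) {j : ℕ} (hj : j < gs.length)
    (h : (gs[j]).fn = GateFn.not) :
    ∃ u : ι ⊕ ℕ, (∀ m, u = .inr m → m < j) ∧ (∀ x, wireFn gs (.inr j) x = !(wireFn gs u x)) ∧
      wireHt gs (.inr j) = wireHt gs u := by
  obtain ⟨h1, hop⟩ := op_of_fn_eq_not h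
  refine ⟨(gs[j]).args ⟨0, by omega⟩, fun m hm => args_lt hwf hj _ hm, fun x => ?_, ?_⟩
  · rw [wireFn_gate hwf hj, hop]
  · rw [wireHt_gate hwf hj, h]
    simp only [acWeight, if_true, zero_add]
    apply le_antisymm
    · refine Finset.sup_le fun a _ => ?_
      have ha : a = ⟨0, by omega⟩ := Fin.ext (by have := a.isLt; omega)
      rw [ha]
    · exact Finset.le_sup (f := fun a : Fin (gs[j]).arity => wireHt gs ((gs[j]).args a)) (mem_univ _)

/-- **Disjunction gates**: value, and the arguments are earlier wires of smaller height. [folklore] -/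
theorem or_gate_spec {gs : List (Gate ι)} (hwf : WF gs) {j : ℕ} (hj : j < gs.length) {k : ℕ}
    (h : (gs[j]).fn = GateFn.or k) :
    (∀ x, wireFn gs (.inr j) x = decide (∃ a : Fin (gs[j]).arity, wireFn gs ((gs[j]).args a) x = true)) ∧
      (∀ a : Fin (gs[j]).arity, wireHt gs ((gs[j]).args a) + 1 ≤ wireHt gs (.inr j)) ∧ 1 ≤ wireHt gs (.inr j) := by
  have hw : acWeight (gs[j]).fn = 1 := by rw [h, acWeight, if_neg (GateFn.or_ne_not k)]
  refine ⟨fun x => ?_, fun a => ?_, ?_⟩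
  · rw [wireFn_gate hwf hj, op_of_fn_eq_or h]
  · rw [wireHt_gate hwf hj, hw, Nat.add_comm 1]
    exact Nat.add_le_add_right (Finset.le_sup (f := fun a : Fin (gs[j]).arity => wireHt gs ((gs[j]).args a)) (mem_univ a)) 1
  · rw [wireHt_gate hwf hj, hw]; exact Nat.le_add_right _ _

/-- **Conjunction gates**: value, and the arguments are earlier wires of smaller height. [folklore] -/
theorem and_gate_spec {gs : List (Gate ι)} (hwf : WF gs) {j : ℕ} (hj : j < gs.length) {k : ℕ}
    (h : (gs[j]).fn = GateFn.and k) :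
    (∀ x, wireFn gs (.inr j) x = decide (∀ a : Fin (gs[j]).arity, wireFn gs ((gs[j]).args a) x = true)) ∧
      (∀ a : Fin (gs[j]).arity, wireHt gs ((gs[j]).args a) + 1 ≤ wireHt gs (.inr j)) ∧ 1 ≤ wireHt gs (.inr j) := by
  have hw : acWeight (gs[j]).fn = 1 := by rw [h, acWeight, if_neg (GateFn.and_ne_not k)]
  refine ⟨fun x => ?_, fun a => ?_, ?_⟩
  · rw [wireFn_gate hwf hj, op_of_fn_eq_and h]
  · rw [wireHt_gate hwf hj, hw, Nat.add_comm 1]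
    exact Nat.add_le_add_right (Finset.le_sup (f := fun a : Fin (gs[j]).arity => wireHt gs ((gs[j]).args a)) (mem_univ a)) 1
  · rw [wireHt_gate hwf hj, hw]; exact Nat.le_add_right _ _

/-- The gates of a circuit over `acBasis` are negations, conjunctions or disjunctions. [folklore] -/
theorem acBasis_trichotomy {gs : List (Gate ι)} (hB : ∀ g ∈ gs, g.fn ∈ acBasis) {j : ℕ} (hj : j < gs.length) :
    (gs[j]).fn = GateFn.not ∨ ∃ k, (gs[j]).fn = GateFn.and k ∨ (gs[j]).fn = GateFn.or k :=
  (mem_acBasis_iff _).1 (hB _ (List.getElem_mem hj))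

end GateList

open GateList

namespace HastadParity

/-! ### Good wires: small decision trees under a restriction -/

/-- The wire `w` of the program `gs` is *good* under `τ` with bound `d`: the restricted function
`x ↦ wireFn gs w (τ.apply x)` has a decision tree of depth `≤ d`. [cite: Beame1994, §3] -/
def GoodWire (gs : List (Gate (Fin n))) (τ : PAssign n) (d : ℕ) (w : Fin n ⊕ ℕ) : Prop :=
  ∃ T : DecisionTree n, T.depth ≤ d ∧ ∀ x, T.eval x = wireFn gs w (τ.apply x)

variable {gs : List (Gate (Fin n))}

/-- Goodness is monotone in the depth bound. [folklore] -/
theorem GoodWire.mono {τ : PAssign n} {d d' : ℕ} {w : Fin n ⊕ ℕ} (h : GoodWire gs τ d w) (hd : d ≤ d') :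
    GoodWire gs τ d' w := by
  obtain ⟨T, hT, hTe⟩ := h
  exact ⟨T, hT.trans hd, hTe⟩

/-- Goodness passes to refinements (restrict the tree). [folklore] -/
theorem GoodWire.refine {τ ρ : PAssign n} {d : ℕ} {w : Fin n ⊕ ℕ} (h : GoodWire gs τ d w)
    (href : ∀ x, τ.apply (ρ.apply x) = ρ.apply x) : GoodWire gs ρ d w := by
  obtain ⟨T, hT, hTe⟩ := h
  refine ⟨T.restrict ρ, (DecisionTree.depth_restrict_le ρ T).trans hT, fun x => ?_⟩
  rw [DecisionTree.eval_restrict, hTe, href]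

/-- Input wires are good (depth `1`). [folklore] -/
theorem goodWire_inl (τ : PAssign n) {d : ℕ} (hd : 1 ≤ d) (i : Fin n) : GoodWire gs τ d (.inl i) := by
  refine ⟨(DecisionTree.var i).restrict τ, (DecisionTree.depth_restrict_le τ _).trans (by simpa using hd),
    fun x => ?_⟩
  rw [DecisionTree.eval_restrict, DecisionTree.eval_var, wireFn_inl]

/-- A wire carrying the negation of a good wire is good (negate the tree). [folklore] -/
theorem GoodWire.of_not {τ : PAssign n} {d : ℕ} {u : Fin n ⊕ ℕ} {j : ℕ} (hu : GoodWire gs τ d u)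
    (hnot : ∀ x, wireFn gs (.inr j) x = !(wireFn gs u x)) : GoodWire gs τ d (.inr j) := by
  obtain ⟨T, hT, hTe⟩ := hu
  refine ⟨T.negate, by simpa using hT, fun x => ?_⟩
  rw [DecisionTree.eval_negate, hTe, hnot]

open Classical in
/-- A chosen small tree of a wire (a dummy leaf if the wire is not good). [folklore] -/
def treeOf (gs : List (Gate (Fin n))) (τ : PAssign n) (d : ℕ) (w : Fin n ⊕ ℕ) : DecisionTree n :=
  if h : GoodWire gs τ d w then Classical.choose h else .leaf false

/-- The chosen tree is small. [folklore] -/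
theorem depth_treeOf_le (τ : PAssign n) (d : ℕ) (w : Fin n ⊕ ℕ) : (treeOf gs τ d w).depth ≤ d := by
  unfold treeOf
  split_ifs with h
  · exact (Classical.choose_spec h).1
  · exact Nat.zero_le _

/-- The chosen tree of a good wire computes the restricted wire function. [folklore] -/
theorem eval_treeOf {τ : PAssign n} {d : ℕ} {w : Fin n ⊕ ℕ} (h : GoodWire gs τ d w) (x : Fin n → Bool) :
    (treeOf gs τ d w).eval x = wireFn gs w (τ.apply x) := by
  unfold treeOf
  rw [dif_pos h]
  exact (Classical.choose_spec h).2 x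

/-- **The invariant after a round**: every gate of height `≤ h` is good with bound `d`. [cite: Hastad1986, Thm. 1] -/
def Inv (gs : List (Gate (Fin n))) (τ : PAssign n) (h d : ℕ) : Prop :=
  ∀ j, j < gs.length → wireHt gs (.inr j) ≤ h → GoodWire gs τ d (.inr j)

/-- Under the invariant every valid wire of height `≤ h` is good. [folklore] -/
theorem Inv.goodWire {τ : PAssign n} {h d : ℕ} (hinv : Inv gs τ h d) (hd : 1 ≤ d) {w : Fin n ⊕ ℕ}
    (hw : OutOK gs.length w) (hht : wireHt gs w ≤ h) : GoodWire gs τ d w := by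
  cases w with
  | inl i => exact goodWire_inl τ hd i
  | inr m => exact hinv m (hw m rfl) hht

/-! ### The DNF attached to a gate -/

/-- The DNF attached to the gate `g` under `τ` (children trees of depth `≤ d`): for a disjunction
gate the union of the path DNFs of the children's trees (a DNF for the gate); otherwise the union
of the path DNFs of the negated trees (for a conjunction gate, a DNF for the NEGATION of the gate).
[cite: Hastad1986, Thm. 1] -/
def gateDNF (gs : List (Gate (Fin n))) (τ : PAssign n) (d : ℕ) (g : Gate (Fin n)) : CNF (Fin n) :=
  if g.fn = GateFn.or g.arity then
    (List.ofFn fun a : Fin g.arity => (treeOf gs τ d (g.args a)).pathDNF []).flatten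
  else
    (List.ofFn fun a : Fin g.arity => (treeOf gs τ d (g.args a)).negate.pathDNF []).flatten

/-- The attached DNF has repetition-free terms of width `≤ d`. [folklore] -/
theorem gateDNF_wf (τ : PAssign n) (d : ℕ) (g : Gate (Fin n)) :
    ∀ Cl ∈ gateDNF gs τ d g, VarNodup Cl ∧ Cl.length ≤ d := by
  intro Cl hCl
  unfold gateDNF at hCl
  split_ifs at hCl with hor
  · obtain ⟨l, hl, hCl⟩ := List.mem_flatten.1 hCl
    obtain ⟨a, rfl⟩ := List.mem_ofFn.1 hl
    exact ⟨DecisionTree.varNodup_of_mem_pathDNF_nil _ hCl,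
      (DecisionTree.length_le_depth_of_mem_pathDNF _ hCl).trans (depth_treeOf_le τ d _)⟩
  · obtain ⟨l, hl, hCl⟩ := List.mem_flatten.1 hCl
    obtain ⟨a, rfl⟩ := List.mem_ofFn.1 hl
    refine ⟨DecisionTree.varNodup_of_mem_pathDNF_nil _ hCl,
      (DecisionTree.length_le_depth_of_mem_pathDNF _ hCl).trans ?_⟩
    rw [DecisionTree.depth_negate]
    exact depth_treeOf_le τ d _

/-- Semantics of a union of DNFs. [folklore] -/
theorem evalDNF_flatten_ofFn {k : ℕ} (G : Fin k → CNF (Fin n)) (y : Fin n → Bool) :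
    CNF.evalDNF (List.ofFn G).flatten y = true ↔ ∃ a, (G a).evalDNF y = true := by
  unfold CNF.evalDNF
  rw [List.any_eq_true]
  constructor
  · rintro ⟨Cl, hCl, hall⟩
    obtain ⟨l, hl, hCl'⟩ := List.mem_flatten.1 hCl
    obtain ⟨a, rfl⟩ := List.mem_ofFn.1 hl
    exact ⟨a, List.any_eq_true.2 ⟨Cl, hCl', hall⟩⟩
  · rintro ⟨a, ha⟩
    obtain ⟨Cl, hCl, hall⟩ := List.any_eq_true.1 ha
    exact ⟨Cl, List.mem_flatten.2 ⟨G a, List.mem_ofFn.2 ⟨a, rfl⟩, hCl⟩, hall⟩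

/-- **Disjunction gates**: if all children are good, the attached DNF computes the restricted gate. [cite: Hastad1986, Thm. 1] -/
theorem evalDNF_gateDNF_or (hwf : WF gs) {τ : PAssign n} {d : ℕ} {j : ℕ} (hj : j < gs.length)
    (hor : (gs[j]).fn = GateFn.or (gs[j]).arity) (hgood : ∀ a : Fin (gs[j]).arity, GoodWire gs τ d ((gs[j]).args a))
    (y : Fin n → Bool) : (gateDNF gs τ d gs[j]).evalDNF y = wireFn gs (.inr j) (τ.apply y) := by
  obtain ⟨hval, -, -⟩ := or_gate_spec hwf hj hor
  rw [hval, Bool.eq_iff_iff, decide_eq_true_iff]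
  unfold gateDNF
  rw [if_pos hor, evalDNF_flatten_ofFn]
  refine exists_congr fun a => ?_
  rw [DecisionTree.evalDNF_pathDNF, eval_treeOf (hgood a)]

/-- **Conjunction gates**: if all children are good, the attached DNF computes the NEGATION of the
restricted gate. [cite: Hastad1986, Thm. 1] -/
theorem evalDNF_gateDNF_and (hwf : WF gs) {τ : PAssign n} {d : ℕ} {j : ℕ} (hj : j < gs.length) {k : ℕ}
    (hand : (gs[j]).fn = GateFn.and k) (hnor : ¬ (gs[j]).fn = GateFn.or (gs[j]).arity)
    (hgood : ∀ a : Fin (gs[j]).arity, GoodWire gs τ d ((gs[j]).args a)) (y : Fin n → Bool) :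
    (gateDNF gs τ d gs[j]).evalDNF y = !(wireFn gs (.inr j) (τ.apply y)) := by
  obtain ⟨hval, -, -⟩ := and_gate_spec hwf hj hand
  rw [hval, Bool.eq_iff_iff]
  unfold gateDNF
  rw [if_neg hnor, evalDNF_flatten_ofFn]
  simp only [Bool.not_eq_true', decide_eq_false_iff_not, not_forall]
  refine exists_congr fun a => ?_
  rw [DecisionTree.evalDNF_pathDNF, DecisionTree.eval_negate, eval_treeOf (hgood a)]
  simp

/-- A gate of `acBasis` that is neither a negation nor a disjunction is a conjunction. [folklore] -/
theorem exists_fn_eq_and (hB : ∀ g ∈ gs, g.fn ∈ acBasis) {j : ℕ} (hj : j < gs.length)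
    (hnot : (gs[j]).fn ≠ GateFn.not) (hnor : ¬ (gs[j]).fn = GateFn.or (gs[j]).arity) :
    ∃ k, (gs[j]).fn = GateFn.and k := by
  rcases acBasis_trichotomy hB hj with h | ⟨k, h | h⟩
  · exact absurd h hnot
  · exact ⟨k, h⟩
  · exfalso; apply hnor
    have hk : k = (gs[j]).arity := (congrArg Sigma.fst h).symm
    rw [h, hk]

/-- The children of an `∧`/`∨` gate (weight `1`) of height `≤ h + 1` have height `≤ h`, and the
gate has height `≥ 1`. [folklore] -/
theorem children_ht (hwf : WF gs) (hB : ∀ g ∈ gs, g.fn ∈ acBasis) {j : ℕ} (hj : j < gs.length)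
    (hnot : (gs[j]).fn ≠ GateFn.not) :
    (∀ a : Fin (gs[j]).arity, wireHt gs ((gs[j]).args a) + 1 ≤ wireHt gs (.inr j)) ∧ 1 ≤ wireHt gs (.inr j) := by
  rcases acBasis_trichotomy hB hj with h | ⟨k, h | h⟩
  · exact absurd h hnot
  · exact (and_gate_spec hwf hj h).2
  · exact (or_gate_spec hwf hj h).2

/-- The argument wires of a gate are valid wires of the program. [folklore] -/
theorem outOK_args (hwf : WF gs) {j : ℕ} (hj : j < gs.length) (a : Fin (gs[j]).arity) :
    OutOK gs.length ((gs[j]).args a) := fun _ hm => (args_lt hwf hj a hm).trans hj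

/-! ### The invariant: base and step -/

/-- **Base**: before any restriction, the gates of height `0` (chains of negations over an input)
have decision trees of depth `1`. [cite: Hastad1986, Thm. 1] -/
theorem inv_zero (hwf : WF gs) (hB : ∀ g ∈ gs, g.fn ∈ acBasis) (τ : PAssign n) : Inv gs τ 0 1 := by
  intro j
  induction j using Nat.strong_induction_on with
  | _ j ih =>
    intro hj hht
    by_cases hnot : (gs[j]).fn = GateFn.not
    · obtain ⟨u, hu, hval, hhtu⟩ := not_gate_spec hwf hj hnot
      refine GoodWire.of_not ?_ hval
      cases u with
      | inl i => exact goodWire_inl τ le_rfl i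
      | inr m =>
        have hm := hu m rfl
        exact ih m hm (hm.trans hj) (by rw [← hhtu]; exact hht)
    · have := (children_ht hwf hB hj hnot).2
      omega

/-- **Step** (the deterministic part of a round): if every gate of height `≤ h` is good under `τ`
with bound `d ≤ s`, `ρ` refines `τ`, and for every `∧`/`∨` gate of height `h + 1` the canonical
decision tree of its attached DNF under `ρ` has depth `≤ s`, then every gate of height `≤ h + 1`
is good under `ρ` with bound `s`. [cite: Hastad1986, Thm. 1] -/
theorem inv_step (hwf : WF gs) (hB : ∀ g ∈ gs, g.fn ∈ acBasis) {τ ρ : PAssign n} {h d s : ℕ}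
    (hd : 1 ≤ d) (hds : d ≤ s) (hinv : Inv gs τ h d) (href : ∀ x, τ.apply (ρ.apply x) = ρ.apply x)
    (hgood : ∀ j (hj : j < gs.length), wireHt gs (.inr j) = h + 1 → (gs[j]).fn ≠ GateFn.not →
      cdt (gateDNF gs τ d gs[j]) ρ ≤ s) :
    Inv gs ρ (h + 1) s := by
  have hs : 1 ≤ s := hd.trans hds
  intro j
  induction j using Nat.strong_induction_on with
  | _ j ih =>
    intro hj hht
    by_cases hnot : (gs[j]).fn = GateFn.not
    · obtain ⟨u, hu, hval, hhtu⟩ := not_gate_spec hwf hj hnot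
      refine GoodWire.of_not ?_ hval
      cases u with
      | inl i => exact goodWire_inl ρ hs i
      | inr m =>
        have hm := hu m rfl
        exact ih m hm (hm.trans hj) (by rw [← hhtu]; exact hht)
    · obtain ⟨hch, h1⟩ := children_ht hwf hB hj hnot
      by_cases hle : wireHt gs (.inr j) ≤ h
      · exact ((hinv j hj hle).refine href).mono hds
      · have heq : wireHt gs (.inr j) = h + 1 := by omega
        have hgoodch : ∀ a : Fin (gs[j]).arity, GoodWire gs τ d ((gs[j]).args a) := fun a =>
          hinv.goodWire hd (outOK_args hwf hj a) (by have := hch a; omega)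
        have hcdt := hgood j hj heq hnot
        have hwfF := gateDNF_wf (gs := gs) τ d gs[j]
        obtain ⟨T, hT, hTe⟩ := exists_decisionTree_of_cdt_le (fun Cl hCl => (hwfF Cl hCl).1) hcdt
        by_cases hor : (gs[j]).fn = GateFn.or (gs[j]).arity
        · refine ⟨T, hT, fun x => ?_⟩
          rw [hTe, evalDNF_gateDNF_or hwf hj hor hgoodch, href]
        · obtain ⟨k, hand⟩ := exists_fn_eq_and hB hj hnot hor
          refine ⟨T.negate, by simpa using hT, fun x => ?_⟩
          rw [DecisionTree.eval_negate, hTe, evalDNF_gateDNF_and hwf hj hand hor hgoodch, href, Bool.not_not]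

/-! ### The end of the induction: small DNFs/CNFs, and parity -/

/-- `f ∘ τ.apply` has a DNF of width `≤ s`. [folklore] -/
def HasSmallDNF (τ : PAssign n) (s : ℕ) (f : (Fin n → Bool) → Bool) : Prop :=
  ∃ F : CNF (Fin n), (∀ Cl ∈ F, Cl.length ≤ s) ∧ ∀ y, F.evalDNF y = f (τ.apply y)

/-- An input wire has a DNF of width `≤ 1` under any restriction. [folklore] -/
theorem hasSmallDNF_inl (τ : PAssign n) {s : ℕ} (hs : 1 ≤ s) (i : Fin n) :
    HasSmallDNF τ s (wireFn gs (.inl i)) := by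
  by_cases hi : i ∈ τ.dom
  · cases hv : τ.val i
    · refine ⟨[], by simp, fun y => ?_⟩
      simp [CNF.evalDNF, apply_apply, hi, hv]
    · refine ⟨[[]], by simp, fun y => ?_⟩
      simp [CNF.evalDNF, apply_apply, hi, hv]
  · refine ⟨[[(i, true)]], by simpa using hs, fun y => ?_⟩
    simp [CNF.evalDNF, apply_apply, hi, Literal.eval]

/-- **After the last round**: under the invariant at height `h` with bound `s`, every valid wire of
height `≤ h + 1` is, after `τ`, an `s`-DNF or the negation of an `s`-DNF (an `s`-CNF). [cite: Hastad1986, Thm. 1] -/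
theorem hasSmallDNF_or (hwf : WF gs) (hB : ∀ g ∈ gs, g.fn ∈ acBasis) {τ : PAssign n} {h s : ℕ}
    (hs : 1 ≤ s) (hinv : Inv gs τ h s) :
    ∀ j, j < gs.length → wireHt gs (.inr j) ≤ h + 1 →
      HasSmallDNF τ s (wireFn gs (.inr j)) ∨ HasSmallDNF τ s (fun y => !wireFn gs (.inr j) y) := by
  intro j
  induction j using Nat.strong_induction_on with
  | _ j ih =>
    intro hj hht
    by_cases hnot : (gs[j]).fn = GateFn.not
    · obtain ⟨u, hu, hval, hhtu⟩ := not_gate_spec hwf hj hnot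
      have hu' : HasSmallDNF τ s (wireFn gs u) ∨ HasSmallDNF τ s (fun y => !wireFn gs u y) := by
        cases u with
        | inl i => exact Or.inl (hasSmallDNF_inl τ hs i)
        | inr m =>
          have hm := hu m rfl
          exact ih m hm (hm.trans hj) (by rw [← hhtu]; exact hht)
      rcases hu' with ⟨F, hF, hFe⟩ | ⟨F, hF, hFe⟩
      · refine Or.inr ⟨F, hF, fun y => ?_⟩
        show F.evalDNF y = !wireFn gs (.inr j) (τ.apply y)
        rw [hFe, hval, Bool.not_not]
      · refine Or.inl ⟨F, hF, fun y => ?_⟩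
        have hFe' : F.evalDNF y = !wireFn gs u (τ.apply y) := hFe y
        rw [hFe', hval]
    · obtain ⟨hch, h1⟩ := children_ht hwf hB hj hnot
      have hgoodch : ∀ a : Fin (gs[j]).arity, GoodWire gs τ s ((gs[j]).args a) := fun a =>
        hinv.goodWire hs (outOK_args hwf hj a) (by have := hch a; omega)
      have hwfF := gateDNF_wf (gs := gs) τ s gs[j]
      by_cases hor : (gs[j]).fn = GateFn.or (gs[j]).arity
      · exact Or.inl ⟨gateDNF gs τ s gs[j], fun Cl hCl => (hwfF Cl hCl).2,
          evalDNF_gateDNF_or hwf hj hor hgoodch⟩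
      · obtain ⟨k, hand⟩ := exists_fn_eq_and hB hj hnot hor
        exact Or.inr ⟨gateDNF gs τ s gs[j], fun Cl hCl => (hwfF Cl hCl).2,
          evalDNF_gateDNF_and hwf hj hand hor hgoodch⟩

/-- Restricting after flipping a free input flips the restricted input. [folklore] -/
theorem apply_update_of_not_mem {τ : PAssign n} {i : Fin n} (hi : i ∉ τ.dom) (y : Fin n → Bool) (b : Bool) :
    τ.apply (Function.update y i b) = Function.update (τ.apply y) i b := by
  funext j
  by_cases hji : j = i
  · subst hji; simp [apply_apply, hi]
  · simp [apply_apply, Function.update_of_ne hji]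

/-- Setting a `0`-coordinate to `1` raises the number of ones by one. [folklore] -/
theorem numOnes_update_true {z : Fin n → Bool} {i : Fin n} (hz : z i = false) :
    GateFn.numOnes (Function.update z i true) = GateFn.numOnes z + 1 := by
  unfold GateFn.numOnes
  have hset : (univ.filter fun j => Function.update z i true j = true) =
      insert i (univ.filter fun j => z j = true) := by
    ext j
    by_cases hji : j = i
    · subst hji; simp
    · simp [hji]
  rw [hset, card_insert_of_notMem (by simp [hz])]

/-- **Parity is sensitive to every free variable.** [folklore] -/
theorem parityFn_update_ne (z : Fin n → Bool) (i : Fin n) :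
    parityFn n (Function.update z i (!z i)) ≠ parityFn n z := by
  have key : ∀ w : Fin n → Bool, w i = false → parityFn n (Function.update w i true) ≠ parityFn n w := by
    intro w hw
    simp only [parityFn, numOnes_update_true hw, ne_eq, decide_eq_decide]
    omega
  cases hz : z i
  · simpa using key z hz
  · have h := key (Function.update z i false) (by simp)
    rw [Function.update_idem, ← hz, Function.update_eq_self] at h
    simpa [hz] using h.symm

/-- **An `s`-DNF cannot compute a function sensitive to more than `s` free variables** (applied to
parity and its negation). [cite: Hastad1986, Thm. 1] -/
theorem not_hasSmallDNF_of_sensitive {τ : PAssign n} {s : ℕ} (hfree : s < τ.free.card)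
    {f : (Fin n → Bool) → Bool} (hsens : ∀ (z : Fin n → Bool) (i : Fin n), f (Function.update z i (!z i)) ≠ f z) :
    ¬ HasSmallDNF τ s f := by
  rintro ⟨F, hF, hFe⟩
  -- an input where `f ∘ τ.apply` is true
  have hne : τ.free.Nonempty := Finset.card_pos.1 (by omega)
  obtain ⟨i₀, hi₀⟩ := hne
  have hi₀d : i₀ ∉ τ.dom := mem_free.1 hi₀
  obtain ⟨y, hy⟩ : ∃ y : Fin n → Bool, f (τ.apply y) = true := by
    by_cases h0 : f (τ.apply fun _ => false) = true
    · exact ⟨_, h0⟩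
    · refine ⟨Function.update (fun _ => false) i₀ true, ?_⟩
      have h1 := hsens (τ.apply fun _ => false) i₀
      have h2 : (τ.apply fun _ : Fin n => false) i₀ = false := by simp [apply_apply, hi₀d]
      rw [h2, Bool.not_false, ← apply_update_of_not_mem hi₀d] at h1
      cases hf : f (τ.apply (Function.update (fun _ => false) i₀ true))
      · exact absurd (hf.trans (eq_false_of_ne_true h0).symm) h1
      · rfl
  -- a satisfied term, and a free variable it does not mention
  have hFy : F.evalDNF y = true := by rw [hFe, hy]
  obtain ⟨Cl, hCl, hall⟩ := List.any_eq_true.1 hFy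
  have hcard : ((Cl.map Prod.fst).toFinset).card < τ.free.card :=
    lt_of_le_of_lt ((List.toFinset_card_le _).trans (by simpa using hF Cl hCl)) hfree
  obtain ⟨i, hi, hiCl⟩ : ∃ i ∈ τ.free, i ∉ (Cl.map Prod.fst).toFinset := by
    by_contra hcon
    push Not at hcon
    exact absurd (Finset.card_le_card hcon) (not_le.2 hcard)
  have hid : i ∉ τ.dom := mem_free.1 hi
  -- flip it
  set y' := Function.update y i (!y i) with hy'
  have hall' : Cl.all (Literal.eval y') = true := by
    rw [List.all_eq_true] at hall ⊢
    intro l hl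
    have hli : l.1 ≠ i := by
      intro h; apply hiCl; rw [List.mem_toFinset]; exact List.mem_map.2 ⟨l, hl, h⟩
    have := hall l hl
    simp only [Literal.eval, hy'] at this ⊢
    rwa [Function.update_of_ne hli]
  have hFy' : F.evalDNF y' = true := List.any_eq_true.2 ⟨Cl, hCl, hall'⟩
  rw [hFe, hy', apply_update_of_not_mem hid] at hFy'
  have h3 := hsens (τ.apply y) i
  have h4 : (τ.apply y) i = y i := by simp [apply_apply, hid]
  rw [h4, hFy', hy] at h3
  exact h3 rfl

/-- Parity of the restricted input has no `s`-DNF when more than `s` variables are free. [cite: Hastad1986, Thm. 1] -/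
theorem not_hasSmallDNF_parity {τ : PAssign n} {s : ℕ} (hfree : s < τ.free.card) :
    ¬ HasSmallDNF τ s (parityFn n) :=
  not_hasSmallDNF_of_sensitive hfree (parityFn_update_ne)

/-- Nor has its negation. [cite: Hastad1986, Thm. 1] -/
theorem not_hasSmallDNF_not_parity {τ : PAssign n} {s : ℕ} (hfree : s < τ.free.card) :
    ¬ HasSmallDNF τ s (fun y => !parityFn n y) :=
  not_hasSmallDNF_of_sensitive hfree fun z i h => parityFn_update_ne z i (by
    have h' : (!parityFn n (Function.update z i (!z i))) = !parityFn n z := h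
    exact Bool.not_inj h')

/-! ### One round: a good restriction exists -/

/-- **One round of restriction** (Håstad 1986, proof of Thm. 1; union bound over the gates): if
every gate of height `≤ h` is good under `τ` with bound `d ≤ s`, `|free τ| = v`,
`s + 1 ≤ ℓ ≤ v`, `(2 (32(d+1)+1) + 1) ℓ ≤ v + 1` and the program has fewer than `2^s` gates, then
some extension `ρ` of `τ` leaving exactly `ℓ` variables free makes every gate of height `≤ h + 1`
good with bound `s`. [cite: Hastad1986, Thm. 1] -/
theorem round_exists (hwf : WF gs) (hB : ∀ g ∈ gs, g.fn ∈ acBasis) {τ : PAssign n} {h d s ℓ : ℕ}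
    (hd : 1 ≤ d) (hds : d ≤ s) (hinv : Inv gs τ h d) (hsl : s + 1 ≤ ℓ) (hlv : ℓ ≤ τ.free.card)
    (hroom : (2 * (32 * (d + 1) + 1) + 1) * ℓ ≤ τ.free.card + 1) (hsize : gs.length < 2 ^ s) :
    ∃ ρ ∈ τ.rext ℓ, Inv gs ρ (h + 1) s := by
  classical
  set v := τ.free.card with hv
  set Y := 32 * (d + 1) + 1 with hY
  set R := τ.rext ℓ with hR
  let Bad : Fin gs.length → Finset (PAssign n) := fun j =>
    R.filter fun ρ => s < cdt (gateDNF gs τ d gs[j]) ρ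
  set U := univ.biUnion Bad with hU
  -- each bad set is small (the switching lemma)
  have hbad : ∀ j, (Bad j).card * (v - ℓ + 1) ^ (s + 1) ≤ R.card * (2 * Y ^ (s + 1) * ℓ ^ (s + 1)) :=
    fun j => switching_rext (gateDNF gs τ d gs[j]) d s (fun Cl hCl => (gateDNF_wf τ d _ Cl hCl).1)
      (fun Cl hCl => (gateDNF_wf τ d _ Cl hCl).2) τ hsl hlv
  have hUle : U.card * (v - ℓ + 1) ^ (s + 1) ≤ gs.length * (R.card * (2 * Y ^ (s + 1) * ℓ ^ (s + 1))) :=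
    calc U.card * (v - ℓ + 1) ^ (s + 1)
        ≤ (∑ j, (Bad j).card) * (v - ℓ + 1) ^ (s + 1) := Nat.mul_le_mul_right _ card_biUnion_le
      _ = ∑ j, (Bad j).card * (v - ℓ + 1) ^ (s + 1) := Finset.sum_mul _ _ _
      _ ≤ ∑ _j : Fin gs.length, R.card * (2 * Y ^ (s + 1) * ℓ ^ (s + 1)) := Finset.sum_le_sum fun j _ => hbad j
      _ = gs.length * (R.card * (2 * Y ^ (s + 1) * ℓ ^ (s + 1))) := by simp
  -- arithmetic: the union bound leaves room
  have h2Y : 2 * Y * ℓ ≤ v - ℓ + 1 := by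
    have : (2 * Y + 1) * ℓ = 2 * Y * ℓ + ℓ := by ring
    omega
  have hkey : gs.length * (2 * Y ^ (s + 1) * ℓ ^ (s + 1)) < (v - ℓ + 1) ^ (s + 1) := by
    have e : gs.length * (2 * Y ^ (s + 1) * ℓ ^ (s + 1)) * 2 ^ s = gs.length * (2 * Y * ℓ) ^ (s + 1) := by ring
    have hpos : 0 < (v - ℓ + 1) ^ (s + 1) := Nat.pow_pos (Nat.succ_pos _)
    have h1 : gs.length * (2 * Y * ℓ) ^ (s + 1) < 2 ^ s * (v - ℓ + 1) ^ (s + 1) :=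
      calc gs.length * (2 * Y * ℓ) ^ (s + 1)
          ≤ gs.length * (v - ℓ + 1) ^ (s + 1) := Nat.mul_le_mul_left _ (Nat.pow_le_pow_left h2Y _)
        _ < 2 ^ s * (v - ℓ + 1) ^ (s + 1) := Nat.mul_lt_mul_of_lt_of_le hsize le_rfl hpos
    rw [← e, mul_comm (2 ^ s)] at h1
    exact Nat.lt_of_mul_lt_mul_right h1
  have hRpos : 0 < R.card := by
    rw [hR, card_rext]
    exact Nat.mul_pos (Nat.choose_pos hlv) (card_valPart_pos τ)
  have hUR : U.card < R.card := by
    have : U.card * (v - ℓ + 1) ^ (s + 1) < R.card * (v - ℓ + 1) ^ (s + 1) :=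
      calc U.card * (v - ℓ + 1) ^ (s + 1)
          ≤ gs.length * (R.card * (2 * Y ^ (s + 1) * ℓ ^ (s + 1))) := hUle
        _ = R.card * (gs.length * (2 * Y ^ (s + 1) * ℓ ^ (s + 1))) := by ring
        _ < R.card * (v - ℓ + 1) ^ (s + 1) := Nat.mul_lt_mul_of_le_of_lt le_rfl hkey hRpos
    exact Nat.lt_of_mul_lt_mul_right this
  -- a good extension
  obtain ⟨ρ, hρR, hρU⟩ := exists_mem_notMem_of_card_lt_card hUR
  refine ⟨ρ, hρR, inv_step hwf hB hd hds hinv (apply_apply_of_mem_rext hρR) fun j hj _ _ => ?_⟩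
  by_contra hc
  push Not at hc
  exact hρU (mem_biUnion.2 ⟨⟨j, hj⟩, mem_univ _, mem_filter.2 ⟨hρR, hc⟩⟩)

/-! ### The schedule of the rounds -/

/-- The number of free variables after `h` rounds: `n`, then `n / 131` (first round, terms of width
`1`), then division by `64 s + 67` at every further round (terms of width `s`). [cite: Hastad1986, Thm. 1] -/
def sched (n s : ℕ) : ℕ → ℕ
  | 0 => n
  | h + 1 => sched n s h / (if h = 0 then 131 else 64 * s + 67)

/-- The depth bound in force after `h` rounds: `1` initially, `s` afterwards. [cite: Hastad1986, Thm. 1] -/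
def dOf (s h : ℕ) : ℕ := if h = 0 then 1 else s

/-- Closed form of the schedule. [folklore] -/
theorem sched_succ (n s : ℕ) : ∀ h, sched n s (h + 1) = n / (131 * (64 * s + 67) ^ h)
  | 0 => by simp [sched]
  | h + 1 => by
    have ih := sched_succ n s h
    show sched n s (h + 1) / (if h + 1 = 0 then 131 else 64 * s + 67) = _
    rw [if_neg (Nat.succ_ne_zero h), ih, Nat.div_div_eq_div_mul, pow_succ, mul_assoc]

/-- If `(131 (s+1))^r ≤ n` then `s + 1` variables survive `r ≥ 1` rounds. [folklore] -/
theorem le_sched {n s r : ℕ} (hr : 1 ≤ r) (h : (131 * (s + 1)) ^ r ≤ n) : s + 1 ≤ sched n s r := by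
  obtain ⟨h', rfl⟩ : ∃ h', r = h' + 1 := ⟨r - 1, by omega⟩
  rw [sched_succ]
  have hpos : 0 < 131 * (64 * s + 67) ^ h' := by positivity
  rw [Nat.le_div_iff_mul_le hpos]
  calc (s + 1) * (131 * (64 * s + 67) ^ h')
      ≤ (s + 1) * (131 * (131 * (s + 1)) ^ h') :=
        Nat.mul_le_mul_left _ (Nat.mul_le_mul_left _ (Nat.pow_le_pow_left (by omega) _))
    _ = (131 * (s + 1)) ^ (h' + 1) := by ring
    _ ≤ n := h

/-- **The rounds** (Håstad 1986, proof of Thm. 1): for a program over `acBasis` with fewer than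
`2^s` gates, as long as the schedule keeps at least `s + 1` variables, after `h` rounds there is a
restriction leaving exactly `sched n s h` variables free under which every gate of height `≤ h`
has a decision tree of depth `≤ dOf s h`. [cite: Hastad1986, Thm. 1] -/
theorem rounds (hwf : WF gs) (hB : ∀ g ∈ gs, g.fn ∈ acBasis) {s : ℕ} (hs : 1 ≤ s)
    (hsize : gs.length < 2 ^ s) :
    ∀ h, s + 1 ≤ sched n s h → ∃ τ : PAssign n, τ.free.card = sched n s h ∧ Inv gs τ h (dOf s h)
  | 0, _ => ⟨⟨∅, fun _ => false⟩, by simp [sched, PAssign.free], by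
      simpa [dOf] using inv_zero hwf hB (⟨∅, fun _ => false⟩ : PAssign n)⟩
  | h + 1, hle => by
    have hle' : s + 1 ≤ sched n s h := hle.trans (Nat.div_le_self _ _)
    obtain ⟨τ, hcard, hinv⟩ := rounds hwf hB hs hsize h hle'
    have hd : 1 ≤ dOf s h := by unfold dOf; split_ifs <;> omega
    have hds : dOf s h ≤ s := by unfold dOf; split_ifs <;> omega
    have hM : (if h = 0 then 131 else 64 * s + 67) = 2 * (32 * (dOf s h + 1) + 1) + 1 := by
      unfold dOf; split_ifs <;> ring
    have hℓ : sched n s (h + 1) = sched n s h / (if h = 0 then 131 else 64 * s + 67) := rfl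
    obtain ⟨ρ, hρ, hinv'⟩ := round_exists hwf hB hd hds hinv (ℓ := sched n s (h + 1)) hle
      (by rw [hcard]; exact Nat.div_le_self _ _)
      (by rw [hcard, ← hM, hℓ]; exact (Nat.mul_div_le _ _).trans (Nat.le_succ _)) hsize
    refine ⟨ρ, (mem_rext.1 hρ).2.1, ?_⟩
    have : dOf s (h + 1) = s := if_neg (Nat.succ_ne_zero h)
    rw [this]
    exact hinv'

/-! ### The size bound -/

/-- **Håstad's theorem, combinatorial core**: a circuit over `acBasis` of `acDepth ≤ r + 1`
(`r ≥ 1`) computing the parity of `n` variables has at least `2^s` gates whenever the schedule of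
`r` rounds keeps `s + 1 ≥ 2` variables (e.g. `(131 (s+1))^r ≤ n`). [cite: Hastad1986, Thm. 1] -/
theorem two_pow_le_size (C : Circuit (Fin n)) (hC : C.IsOver acBasis) {r s : ℕ} (hr : 1 ≤ r)
    (hdepth : C.acDepth ≤ r + 1) (hs : 1 ≤ s) (hsched : s + 1 ≤ sched n s r)
    (hcomp : C.Computes (parityFn n)) : 2 ^ s ≤ C.size := by
  by_contra hlt
  push Not at hlt
  have hwf := wf_gates C
  obtain ⟨τ, hcard, hinv⟩ := rounds hwf hC hs hlt r hsched
  have hinv' : Inv C.gates τ r s := by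
    have : dOf s r = s := if_neg (by omega)
    rwa [this] at hinv
  have hfree : s < τ.free.card := by omega
  have hfn : wireFn C.gates C.output = parityFn n := by
    funext x; rw [← circuit_eval_eq_wireFn]; exact hcomp x
  cases hw : C.output with
  | inl i =>
    have h1 := hasSmallDNF_inl (gs := C.gates) τ hs i
    rw [hw] at hfn
    rw [hfn] at h1
    exact not_hasSmallDNF_parity hfree h1
  | inr j =>
    have hj : j < C.gates.length := C.wf_output j hw
    have hht : wireHt C.gates (.inr j) ≤ r + 1 := by
      rw [← hw, ← circuit_acDepth_eq_wireHt]; exact hdepth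
    rw [hw] at hfn
    rcases hasSmallDNF_or hwf hC hs hinv' j hj hht with h1 | h1
    · rw [hfn] at h1
      exact not_hasSmallDNF_parity hfree h1
    · rw [hfn] at h1
      exact not_hasSmallDNF_not_parity hfree h1

end HastadParity

open HastadParity

/-- **Håstad's theorem** (Håstad 1986, Thm. 1; Jukna 2012, Thm. 12.3): `hastad_parity` holds —
for every `k ≥ 2`, with `c = 1/262` and `N = 786^{k-1}`, every circuit over
`acBasis = {¬, ∧ₖ, ∨ₖ}` of `acDepth ≤ k` computing `PARITYₙ`, `n ≥ N`, has at least
`2^{c · n^{1/(k-1)}}` gates. Proof: `k - 1` rounds of restrictions leaving exactly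
`n/131, ·/(64s+67), …` variables free; by the switching lemma (counting form on extensions with a
fixed number of free variables, `switching_rext`, from `SwitchingLemma.lean`) and a union bound
over the `< 2^s` gates, after round `h` every gate of height `≤ h` has a decision tree of depth
`≤ s` (`rounds`); then the output is an `s`-DNF or `s`-CNF of the parity of `> s` free variables,
which is impossible (`two_pow_le_size`); finally `s = ⌊n^{1/(k-1)}⌋/131 - 1 ≥ n^{1/(k-1)}/262`.
[cite: Hastad1986, Thm. 1] -/
theorem hastad_parity_holds : hastad_parity := by
  intro k hk
  obtain ⟨r, rfl⟩ : ∃ r, k = r + 1 := ⟨k - 1, by omega⟩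
  have hr : 1 ≤ r := by omega
  refine ⟨1 / 262, by norm_num, 786 ^ r, fun n hn C hC hdepth hcomp => ?_⟩
  have hkr : ((r + 1 : ℕ) : ℝ) - 1 = r := by push_cast; ring
  rw [hkr]
  set x : ℝ := (n : ℝ) ^ (1 / (r : ℝ)) with hx
  have hx0 : 0 ≤ x := Real.rpow_nonneg (Nat.cast_nonneg n) _
  have hr0 : r ≠ 0 := by omega
  have hxr : x ^ r = n := by
    rw [hx, one_div, Real.rpow_inv_natCast_pow (Nat.cast_nonneg n) hr0]
  have hx786 : (786 : ℝ) ≤ x := by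
    have h1 : ((786 : ℝ) ^ r) ^ (1 / (r : ℝ)) = 786 := by
      rw [one_div, Real.pow_rpow_inv_natCast (by norm_num) hr0]
    rw [← h1, hx]
    refine Real.rpow_le_rpow (by positivity) ?_ (by positivity)
    exact_mod_cast hn
  -- integer parameters
  set q := ⌊x⌋₊ with hq
  set m := q / 131 with hm
  have hqx : (q : ℝ) ≤ x := Nat.floor_le hx0
  have hxq : x < q + 1 := Nat.lt_floor_add_one x
  have hq786 : 786 ≤ q := Nat.le_floor (by exact_mod_cast hx786)
  set s := m - 1 with hs
  have hm6 : 6 ≤ m := by omega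
  have hs1 : 1 ≤ s := by omega
  have hsm : s + 1 = m := by omega
  -- (131 (s+1))^r ≤ n
  have h131 : (131 * (s + 1)) ^ r ≤ n := by
    rw [hsm]
    have h2 : ((131 * m : ℕ) : ℝ) ≤ x := by
      have : 131 * m ≤ q := by omega
      calc ((131 * m : ℕ) : ℝ) ≤ q := by exact_mod_cast this
        _ ≤ x := hqx
    have h3 : ((131 * m : ℕ) : ℝ) ^ r ≤ x ^ r := pow_le_pow_left₀ (by positivity) h2 r
    rw [hxr] at h3
    exact_mod_cast h3
  have hsched : s + 1 ≤ sched n s r := le_sched hr h131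
  have hsize : 2 ^ s ≤ C.size := two_pow_le_size C hC hr hdepth hs1 hsched hcomp
  -- conclude
  have hsR : (s : ℝ) = m - 1 := by
    rw [← hsm]; push_cast; ring
  have hqm : (q : ℝ) < 131 * m + 131 := by
    have : q < 131 * m + 131 := by omega
    exact_mod_cast this
  have hcs : (1 / 262 : ℝ) * x ≤ s := by
    rw [hsR]; linarith
  calc (2 : ℝ) ^ ((1 / 262 : ℝ) * x) ≤ (2 : ℝ) ^ (s : ℝ) :=
        Real.rpow_le_rpow_of_exponent_le (by norm_num) hcs
    _ = ((2 ^ s : ℕ) : ℝ) := by rw [Real.rpow_natCast]; push_cast; rfl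
    _ ≤ C.size := by exact_mod_cast hsize

end Literature.Computability.Complexity

end

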